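import Literature.Geometry.Kaehler.ComplexTorusAnalyticHypersurfaceSelfIntersection
import Literature.Geometry.Kaehler.ComplexTorusHodgeTypeInequality
import Literature.Geometry.Kaehler.ComplexTorusDivisorClassesLowCodimension
import HarnessLib

/-!
# The Hodge index theorem for analytic curves on a two-dimensional complex torus:
# `(C · C')² ≥ (C²) (C'²)`, equality iff the classes are proportional; `(C²) > 0 ⇒ (C · C') > 0`

Layer `Literature/Geometry/Kaehler`, namespace `Literature.Geometry.Kaehler.ComplexTorus`; lane `lit-hodgefound`
(Track 2 foundations library), prover seat `lit-hodgefound-p07`, leaf (lxii) (self-claimed row g13-#4 of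
`run/shared/lean/pub/lit-hodgefound/SKELETON.md`). Sequel of leaves (lix)–(lxi) of this seat (the class of an
analytic curve `C` on a two-dimensional torus `X` is `[C] = ofRealForm (-E)` for a semi-positive `E ∈ NS(X)`;
`(C · C') ≥ 0`; `(C²) ≥ 0`, and `(C²) ≠ 0` makes `E` a Riemann form) and of row g16-#3
`ComplexTorusHodgeTypeInequality` (seat p16: the Hodge-type inequality `(L₀^{g-1} · L)^g ≥ (L₀^g)^{g-1} (L^g)` for two
POLARISATIONS, with its equality clause), specialised to `g = 2` and extended to the semi-positive classes of
analytic curves, where the degenerate cases are settled by the sign results of leaves (lx)/(lxi); with leaf (lii)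
`ComplexTorusAnalyticCycleDegreePositive` (`deg_L C' > 0`) for the strict positivity `(C · C') > 0`. All consumed
BY NAME.

## Sources (held copies, pages opened), verbatim

* H. Lange, *Abelian Varieties over the Complex Numbers* (Springer 2023) [held `book:lange1992-complex-abelian-varieties`],
  §2.4.2 **Proposition 2.4.13** (chunk p0118 L29): "`d₀ a_ν = (L₀^{g-ν} · L^ν) / ((g-ν)! ν!)`" — the source of row
  g16-#3's inequality; §2.1.3 Prop. 2.1.11 (p0082) and §2.2.1 Lemma 2.2.2 (a)(ii) (p0090: "If `L₁` and `L₂` are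
  positive, then `(L₁^ν · L₂^{g-ν}) > 0`"); §4.1 / p0074 L46 (abelian variety = torus with a positive line bundle).
* W. Fulton, *Intersection Theory* (1998) [held `book:fultonnd-intersection-theory`], §12.2 Cor. 12.2 (a) and
  Example 12.2.1 (a) (chunks p0213–p0214: non-negativity of intersection products on abelian varieties). The Hodge
  index theorem for surfaces is cited from R. Hartshorne, *Algebraic Geometry* (GTM 52, 1977), Ch. V Thm. 1.9 and
  Remark 1.9.1 (if `H` is an ample divisor on the surface `X` and `D` a divisor with `D.H = 0`, then `D² ≤ 0`;
  equivalently `(D.H)² ≥ D² H²` for `H` ample), as already cited by this seat in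
  `ComplexTorusCastelnuovoSeveriNegativeDefinite` (row Q1632) — cited by theorem number, the text is not held, no
  verbatim quote.

## Dictionary and statement

`X = E/Λ` a two-dimensional complex torus (`rk Λ = 4`, `e : Fin (2·2) ≃ ι` a POSITIVELY ORIENTED enumeration,
`orientationSign Φ e = 1`); `C, C' ⊂ X` closed analytic subsets of pure dimension `1` (analytic curves);
`[C], [C'] ∈ H²(X, ℂ)` their classes (`analyticCycleClass Φ e rfl hC`). Intersection numbers as top integrals of
invariant forms: `(C · C') = ∫_X [C] ∧ [C'] = torusIntegral Φ e (wedgeFamily 2 (mixedFamily [C] [C'] 2 1))`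
(`= ⟨[C], [C']⟩_e` of leaf (lx), `poincarePairing_eq_torusIntegral_wedgeFamily_mixedFamily`), `(C²) = ∫_X [C]^{∧2}`.
All three are non-negative reals (leaves (lx), (lxi)). THE RESULTS: **`(C²) (C'²) ≤ (C · C')²`**; when
`(C²) (C'²) ≠ 0`, **equality holds iff `[C'] = c · [C]` for a real `c > 0`**; **`(C²) > 0 ⇒ (C · C') > 0`** for
EVERY analytic curve `C'` (the class of `C` is then a polarisation `-E`, and `(C · C') = deg_E C' > 0`), so a curve
meeting some curve with intersection number `0` has `(C²) = 0`.

## Contents (theorems only; NO definition, NO named fact, net debt 0)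

* §1 bookkeeping: `wedgeFamily_two_mixedFamily_one` (`wedgeFamily 2 (a, b) = a ∧ b`),
  `poincarePairing_eq_torusIntegral_wedgeFamily_mixedFamily` (`⟨[C], [C']⟩_e = ∫_X [C] ∧ [C']` for positively
  oriented `e`), `torusIntegral_wedgeFamily_mixedFamily_analyticCycleClass_nonneg` (`(C · C') ≥ 0` in this form).
* §2 **`hodgeIndex_analyticCurves`** (`(C²)(C'²) ≤ (C · C')²`), **`hodgeIndex_analyticCurves_eq_iff`** (equality iff
  proportional classes, when `(C²)(C'²) ≠ 0`).
* §3 **`torusIntegral_wedgeFamily_mixedFamily_analyticCycleClass_pos_of_self_ne_zero`** (`(C²) ≠ 0 ⇒ (C · C') > 0`),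
  `exists_nat_torusIntegral_wedgeFamily_mixedFamily_analyticCycleClass_eq_succ` (`(C · C') ≥ 1`, an integer),
  `torusIntegral_wedgePow_two_analyticCycleClass_eq_zero_of_mixed_eq_zero` (`(C · C') = 0 ⇒ (C²) = 0`, and `'`).
* §4 any dimension: **`re_poincarePairing_wedgePow_analyticCycleClass_hypersurface_pos_of_top_ne_zero`** — a
  hypersurface with `(D^g) ≠ 0` has `(D^d · Z) > 0` (a positive integer, `exists_pos_…_eq_…`) on every closed
  analytic `Z` of pure dimension `d`.

## References

* [Lange2023AbelianVarietiesComplex] H. Lange, *Abelian Varieties over the Complex Numbers* (2023), §2.1.3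
  Prop. 2.1.11, §2.2.1 Lemma 2.2.2, §2.4.2 Prop. 2.4.13.
* [Hartshorne1977] R. Hartshorne, *Algebraic Geometry*, GTM 52 (1977), Ch. V Thm. 1.9, Remark 1.9.1 (cited by
  number).
* [Fulton1998] W. Fulton, *Intersection Theory*, 2nd ed. (1998), §12.2 Cor. 12.2 (a), Example 12.2.1 (a).
-/

noncomputable section

open scoped Manifold ComplexOrder
open MeasureTheory TopologicalSpace Set Function Complex Module

namespace Literature.Geometry.Kaehler

namespace ComplexTorus

universe u

section Bookkeeping

variable {E : Type u} [NormedAddCommGroup E] [NormedSpace ℂ E]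

/-- `wedgeFamily 2 (a, b) = a ∧ b`: the mixed monomial with one factor `a` and one factor `b` (`1 ∧ a = a`).
[cite: Lange2023AbelianVarietiesComplex, §2.2.1 p. 89] -/
theorem wedgeFamily_two_mixedFamily_one (a b : E [⋀^Fin 2]→L[ℝ] ℂ) :
    wedgeFamily 2 (mixedFamily a b 2 1) = (a : E [⋀^Fin (2 * 1)]→L[ℝ] ℂ).wedge b := by
  rw [show wedgeFamily 2 (mixedFamily a b 2 1) =
      (wedgeFamily 1 (Fin.init (mixedFamily a b 2 1))).wedge (mixedFamily a b 2 1 (Fin.last 1)) from rfl,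
    wedgeFamily_one]
  rfl

end Bookkeeping

section Surface

variable {ι : Type*} [Fintype ι] [DecidableEq ι] {E : Type u} [NormedAddCommGroup E] [InnerProductSpace ℂ E]
  [FiniteDimensional ℂ E] [MeasurableSpace E] [BorelSpace E] (Φ : (ι → ℝ) ≃L[ℝ] E) (e : Fin (2 * 2) ≃ ι)

/-! ### §1 `(C · C') = ⟨[C], [C']⟩ = ∫_X [C] ∧ [C'] ≥ 0` -/

/-- **`⟨[C], [C']⟩_e = ∫_X [C] ∧ [C']`** for a positively oriented enumeration (`⟨γ, δ⟩_e = sign(e) ∫_X γ ∧ δ`), with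
`[C] ∧ [C']` written as the mixed monomial `wedgeFamily 2 (mixedFamily [C] [C'] 2 1)` of row Q124.
[cite: Lange2023AbelianVarietiesComplex, §6.2.4 p. 310] [cite: Fulton1998, §12.2 Cor. 12.2 (a)] -/
theorem poincarePairing_eq_torusIntegral_wedgeFamily_mixedFamily {C C' : Set (ComplexTorus Φ)}
    (hC : HasPureDim 𝓘(ℂ, E) C 1) (hC' : HasPureDim 𝓘(ℂ, E) C' 1) (he : orientationSign Φ e = 1) :
    poincarePairing Φ e (show 2 * 1 + 2 * 1 = 2 * 2 from rfl) (analyticCycleClass Φ e rfl hC)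
        (analyticCycleClass Φ e rfl hC') =
      torusIntegral Φ e (wedgeFamily 2 (mixedFamily (analyticCycleClass Φ e (show 2 * 1 + 2 * 1 = 2 * 2 from rfl) hC)
        (analyticCycleClass Φ e (show 2 * 1 + 2 * 1 = 2 * 2 from rfl) hC') 2 1)) := by
  rw [wedgeFamily_two_mixedFamily_one,
    torusIntegral_wedge_eq_orientationSign_mul_poincarePairing' (k := 2 * 1) (l := 2 * 1) Φ e, he, Int.cast_one,
    one_mul]

/-- **`(C · C') = ∫_X [C] ∧ [C'] ≥ 0`** in the mixed-monomial form (leaf (lx): `sign(e) ⟨[C], [C']⟩ ≥ 0`).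
[cite: Fulton1998, §12.2 Cor. 12.2 (a) and Example 12.2.1 (a)] -/
theorem torusIntegral_wedgeFamily_mixedFamily_analyticCycleClass_nonneg {C C' : Set (ComplexTorus Φ)}
    (hC : HasPureDim 𝓘(ℂ, E) C 1) (hC' : HasPureDim 𝓘(ℂ, E) C' 1) (he : orientationSign Φ e = 1) :
    0 ≤ torusIntegral Φ e (wedgeFamily 2 (mixedFamily (analyticCycleClass Φ e (show 2 * 1 + 2 * 1 = 2 * 2 from rfl) hC)
        (analyticCycleClass Φ e (show 2 * 1 + 2 * 1 = 2 * 2 from rfl) hC') 2 1)) := by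
  rw [← poincarePairing_eq_torusIntegral_wedgeFamily_mixedFamily Φ e hC hC' he]
  exact poincarePairing_analyticCycleClass_analyticCycleClass_nonneg_of_orientationSign_eq_one Φ e rfl rfl hC hC' he

/-! ### §2 The Hodge index inequality `(C²) (C'²) ≤ (C · C')²` and its equality case -/

/-- **The Hodge index theorem for analytic curves on a two-dimensional complex torus:
`(C²) · (C'²) ≤ (C · C')²`** (real parts of the tree's `ℂ`-valued integrals, which are real). If `(C²) = 0` or
`(C'²) = 0` the left side vanishes; otherwise both classes are polarisations (leaf (lxi)) and this is the Hodge-type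
inequality of row g16-#3 at `g = 2`. [cite: Hartshorne1977, Ch. V Thm. 1.9 and Remark 1.9.1 (cited by number)] [cite: Lange2023AbelianVarietiesComplex, §2.4.2 Prop. 2.4.13] -/
theorem hodgeIndex_analyticCurves {C C' : Set (ComplexTorus Φ)} (hC : HasPureDim 𝓘(ℂ, E) C 1)
    (hC' : HasPureDim 𝓘(ℂ, E) C' 1) (he : orientationSign Φ e = 1) :
    (torusIntegral Φ e (wedgePow (analyticCycleClass Φ e (show 2 * 1 + 2 * 1 = 2 * 2 from rfl) hC) 2)).re *
        (torusIntegral Φ e (wedgePow (analyticCycleClass Φ e (show 2 * 1 + 2 * 1 = 2 * 2 from rfl) hC') 2)).re ≤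
      (torusIntegral Φ e (wedgeFamily 2 (mixedFamily (analyticCycleClass Φ e (show 2 * 1 + 2 * 1 = 2 * 2 from rfl) hC)
        (analyticCycleClass Φ e (show 2 * 1 + 2 * 1 = 2 * 2 from rfl) hC') 2 1))).re ^ 2 := by
  haveI : Nonempty ι := ⟨e 0⟩
  by_cases h0 : torusIntegral Φ e (wedgePow (analyticCycleClass Φ e (show 2 * 1 + 2 * 1 = 2 * 2 from rfl) hC) 2) = 0
  · rw [h0, zero_re, zero_mul]; positivity
  by_cases h0' : torusIntegral Φ e (wedgePow (analyticCycleClass Φ e (show 2 * 1 + 2 * 1 = 2 * 2 from rfl) hC') 2) = 0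
  · rw [h0', zero_re, mul_zero]; positivity
  obtain ⟨η, hη, hcl⟩ := exists_isRiemannForm_analyticCycleClass_eq_of_torusIntegral_wedgePow_ne_zero Φ e rfl hC he h0
  obtain ⟨η', hη', hcl'⟩ :=
    exists_isRiemannForm_analyticCycleClass_eq_of_torusIntegral_wedgePow_ne_zero Φ e rfl hC' he h0'
  have h := hη.hodgeTypeInequality hη' e
  rw [show 2 - 1 = 1 from rfl, pow_one] at h
  rw [hcl, hcl']
  exact h

/-- **Equality in the Hodge index inequality**: when `(C²) (C'²) ≠ 0` (both curves have positive self-intersection),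
`(C²) (C'²) = (C · C')²` iff the classes are proportional, `[C'] = c · [C]` for a real `c > 0` (row g16-#3's
equality clause: proportional polarisations). [cite: Lange2023AbelianVarietiesComplex, §2.4.2 Prop. 2.4.13] [cite: Hartshorne1977, Ch. V Thm. 1.9 and Remark 1.9.1 (cited by number)] -/
theorem hodgeIndex_analyticCurves_eq_iff {C C' : Set (ComplexTorus Φ)} (hC : HasPureDim 𝓘(ℂ, E) C 1)
    (hC' : HasPureDim 𝓘(ℂ, E) C' 1) (he : orientationSign Φ e = 1)
    (h0 : torusIntegral Φ e (wedgePow (analyticCycleClass Φ e (show 2 * 1 + 2 * 1 = 2 * 2 from rfl) hC) 2) ≠ 0)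
    (h0' : torusIntegral Φ e (wedgePow (analyticCycleClass Φ e (show 2 * 1 + 2 * 1 = 2 * 2 from rfl) hC') 2) ≠ 0) :
    (torusIntegral Φ e (wedgePow (analyticCycleClass Φ e (show 2 * 1 + 2 * 1 = 2 * 2 from rfl) hC) 2)).re *
          (torusIntegral Φ e (wedgePow (analyticCycleClass Φ e (show 2 * 1 + 2 * 1 = 2 * 2 from rfl) hC') 2)).re =
        (torusIntegral Φ e (wedgeFamily 2 (mixedFamily (analyticCycleClass Φ e (show 2 * 1 + 2 * 1 = 2 * 2 from rfl) hC)
          (analyticCycleClass Φ e (show 2 * 1 + 2 * 1 = 2 * 2 from rfl) hC') 2 1))).re ^ 2 ↔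
      ∃ c : ℝ, 0 < c ∧ analyticCycleClass Φ e (show 2 * 1 + 2 * 1 = 2 * 2 from rfl) hC' =
        (c : ℂ) • analyticCycleClass Φ e (show 2 * 1 + 2 * 1 = 2 * 2 from rfl) hC := by
  haveI : Nonempty ι := ⟨e 0⟩
  obtain ⟨η, hη, hcl⟩ := exists_isRiemannForm_analyticCycleClass_eq_of_torusIntegral_wedgePow_ne_zero Φ e rfl hC he h0
  obtain ⟨η', hη', hcl'⟩ :=
    exists_isRiemannForm_analyticCycleClass_eq_of_torusIntegral_wedgePow_ne_zero Φ e rfl hC' he h0'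
  have h := hη.hodgeTypeInequality_eq_iff hη' e
  rw [show 2 - 1 = 1 from rfl, pow_one] at h
  rw [hcl, hcl', h]
  refine exists_congr fun c ↦ and_congr_right fun _ ↦ ?_
  rw [← ofRealForm_smul, ofRealForm_injective.eq_iff, smul_neg, neg_inj]

/-! ### §3 A curve of positive self-intersection meets every curve: `(C²) ≠ 0 ⇒ (C · C') > 0` -/

/-- **`(C²) ≠ 0 ⇒ (C · C') > 0` for EVERY analytic curve `C'`**: the class of `C` is a polarisation `-E` (leaf
(lxi)), and `(C · C') = ⟨[C], [C']⟩ = ∫_{C'} (-E) = deg_E C' > 0` (leaf (lii), Lange's Lemma 2.2.2 (a)(ii) on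
subvarieties). [cite: Lange2023AbelianVarietiesComplex, §2.2.1 Lemma 2.2.2 (a)(ii) and §2.1.3 Prop. 2.1.11] [cite: Fulton1998, §12.2 Cor. 12.2 (a)] -/
theorem torusIntegral_wedgeFamily_mixedFamily_analyticCycleClass_pos_of_self_ne_zero {C C' : Set (ComplexTorus Φ)}
    (hC : HasPureDim 𝓘(ℂ, E) C 1) (hC' : HasPureDim 𝓘(ℂ, E) C' 1) (he : orientationSign Φ e = 1)
    (h0 : torusIntegral Φ e (wedgePow (analyticCycleClass Φ e (show 2 * 1 + 2 * 1 = 2 * 2 from rfl) hC) 2) ≠ 0) :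
    0 < (torusIntegral Φ e (wedgeFamily 2 (mixedFamily (analyticCycleClass Φ e (show 2 * 1 + 2 * 1 = 2 * 2 from rfl) hC)
        (analyticCycleClass Φ e (show 2 * 1 + 2 * 1 = 2 * 2 from rfl) hC') 2 1))).re := by
  obtain ⟨η, hη, hcl⟩ := exists_isRiemannForm_analyticCycleClass_eq_of_torusIntegral_wedgePow_ne_zero Φ e rfl hC he h0
  have hpos := hη.re_poincarePairing_wedgePow_analyticCycleClass_pos Φ e (show 2 * 1 + 2 * 1 = 2 * 2 from rfl) hC'
  rw [wedgePow_one, show ((Literature.Analysis.Complex.oneForm₀ E).wedge (ofRealForm (-η)) :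
      E [⋀^Fin (2 * 1)]→L[ℝ] ℂ) = ofRealForm (-η) from wedgeFamily_one (fun _ ↦ ofRealForm (-η)), ← hcl,
    poincarePairing_eq_torusIntegral_wedgeFamily_mixedFamily Φ e hC hC' he] at hpos
  exact hpos

/-- **`(C · C')` is then a POSITIVE INTEGER**: `(C · C') = m + 1` for some `m ∈ ℕ`.
[cite: Lange2023AbelianVarietiesComplex, §2.2.1 Lemma 2.2.2 (a)(ii)] [cite: Fulton1998, §12.2 Cor. 12.2 (a)] -/
theorem exists_nat_torusIntegral_wedgeFamily_mixedFamily_analyticCycleClass_eq_succ {C C' : Set (ComplexTorus Φ)}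
    (hC : HasPureDim 𝓘(ℂ, E) C 1) (hC' : HasPureDim 𝓘(ℂ, E) C' 1) (he : orientationSign Φ e = 1)
    (h0 : torusIntegral Φ e (wedgePow (analyticCycleClass Φ e (show 2 * 1 + 2 * 1 = 2 * 2 from rfl) hC) 2) ≠ 0) :
    ∃ m : ℕ, torusIntegral Φ e (wedgeFamily 2 (mixedFamily (analyticCycleClass Φ e (show 2 * 1 + 2 * 1 = 2 * 2 from rfl) hC)
        (analyticCycleClass Φ e (show 2 * 1 + 2 * 1 = 2 * 2 from rfl) hC') 2 1)) = (m + 1 : ℕ) := by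
  obtain ⟨m, hm⟩ :=
    exists_nat_poincarePairing_analyticCycleClass_analyticCycleClass_eq_of_orientationSign_eq_one Φ e rfl rfl hC hC' he
  have hpos := torusIntegral_wedgeFamily_mixedFamily_analyticCycleClass_pos_of_self_ne_zero Φ e hC hC' he h0
  rw [poincarePairing_eq_torusIntegral_wedgeFamily_mixedFamily Φ e hC hC' he] at hm
  rw [hm, natCast_re] at hpos
  obtain ⟨k, rfl⟩ := Nat.exists_eq_succ_of_ne_zero (by exact_mod_cast hpos.ne' : m ≠ 0)
  exact ⟨k, hm⟩

/-- **Contrapositive: `(C · C') = 0` for some analytic curve `C'` forces `(C²) = 0`** (a curve meeting some curve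
with intersection number zero has self-intersection zero). [cite: Hartshorne1977, Ch. V Thm. 1.9 and Remark 1.9.1 (cited by number)] [cite: Lange2023AbelianVarietiesComplex, §2.2.1 Lemma 2.2.2 (a)(ii)] -/
theorem torusIntegral_wedgePow_two_analyticCycleClass_eq_zero_of_mixed_eq_zero {C C' : Set (ComplexTorus Φ)}
    (hC : HasPureDim 𝓘(ℂ, E) C 1) (hC' : HasPureDim 𝓘(ℂ, E) C' 1) (he : orientationSign Φ e = 1)
    (h0 : torusIntegral Φ e (wedgeFamily 2 (mixedFamily (analyticCycleClass Φ e (show 2 * 1 + 2 * 1 = 2 * 2 from rfl) hC)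
        (analyticCycleClass Φ e (show 2 * 1 + 2 * 1 = 2 * 2 from rfl) hC') 2 1)) = 0) :
    torusIntegral Φ e (wedgePow (analyticCycleClass Φ e (show 2 * 1 + 2 * 1 = 2 * 2 from rfl) hC) 2) = 0 := by
  by_contra hne
  have hpos := torusIntegral_wedgeFamily_mixedFamily_analyticCycleClass_pos_of_self_ne_zero Φ e hC hC' he hne
  rw [h0, zero_re] at hpos
  exact lt_irrefl _ hpos

/-- Symmetrically, `(C · C') = 0` also forces `(C'²) = 0`. [cite: Hartshorne1977, Ch. V Thm. 1.9 and Remark 1.9.1 (cited by number)] -/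
theorem torusIntegral_wedgePow_two_analyticCycleClass_eq_zero_of_mixed_eq_zero' {C C' : Set (ComplexTorus Φ)}
    (hC : HasPureDim 𝓘(ℂ, E) C 1) (hC' : HasPureDim 𝓘(ℂ, E) C' 1) (he : orientationSign Φ e = 1)
    (h0 : torusIntegral Φ e (wedgeFamily 2 (mixedFamily (analyticCycleClass Φ e (show 2 * 1 + 2 * 1 = 2 * 2 from rfl) hC)
        (analyticCycleClass Φ e (show 2 * 1 + 2 * 1 = 2 * 2 from rfl) hC') 2 1)) = 0) :
    torusIntegral Φ e (wedgePow (analyticCycleClass Φ e (show 2 * 1 + 2 * 1 = 2 * 2 from rfl) hC') 2) = 0 := by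
  refine torusIntegral_wedgePow_two_analyticCycleClass_eq_zero_of_mixed_eq_zero Φ e hC' hC he ?_
  rw [← poincarePairing_eq_torusIntegral_wedgeFamily_mixedFamily Φ e hC' hC he,
    poincarePairing_analyticCycleClass_analyticCycleClass_comm Φ e rfl rfl hC' hC,
    poincarePairing_eq_torusIntegral_wedgeFamily_mixedFamily Φ e hC hC' he, h0]

end Surface

/-! ### §4 Any dimension: a hypersurface with `(D^g) ≠ 0` has positive degree on every analytic subvariety -/

section AnyDim

variable {ι : Type*} [Fintype ι] [DecidableEq ι] {E : Type u} [NormedAddCommGroup E] [InnerProductSpace ℂ E]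
  [FiniteDimensional ℂ E] [MeasurableSpace E] [BorelSpace E] (Φ : (ι → ℝ) ≃L[ℝ] E) {g q d p : ℕ}
  (e₁ : Fin (2 * g) ≃ ι)

/-- **`(D^d · Z) = ⟨[D]^{∧d}, [Z]⟩ > 0` for every closed analytic `Z` of pure dimension `d`, once `(D^g) ≠ 0`**: the
class of the analytic hypersurface `D` is then a polarisation `-E` (leaf (lxi)), and `deg_E Z > 0` (leaf (lii);
Lange's Lemma 2.2.2 (a)(ii) / de Jong's Thm. 4.3.1 on subvarieties). Positively oriented `e₁`.
[cite: Lange2023AbelianVarietiesComplex, §2.1.3 Prop. 2.1.11 and §2.2.1 Lemma 2.2.2 (a)(ii)] [cite: Fulton1998, §12.2 Cor. 12.2 (d)] -/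
theorem re_poincarePairing_wedgePow_analyticCycleClass_hypersurface_pos_of_top_ne_zero (hq : 2 * q + 2 * 1 = 2 * g)
    (hZ' : 2 * d + 2 * p = 2 * g) {D Z : Set (ComplexTorus Φ)} (hD : HasPureDim 𝓘(ℂ, E) D q)
    (hZ : HasPureDim 𝓘(ℂ, E) Z d) (he : orientationSign Φ e₁ = 1)
    (hDg : torusIntegral Φ e₁ (wedgePow (analyticCycleClass Φ e₁ hq hD) g) ≠ 0) :
    0 < (poincarePairing Φ e₁ hZ' (wedgePow (analyticCycleClass Φ e₁ hq hD) d) (analyticCycleClass Φ e₁ hZ' hZ)).re := by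
  obtain ⟨η, hη, hcl⟩ :=
    exists_isRiemannForm_analyticCycleClass_eq_of_torusIntegral_wedgePow_ne_zero Φ e₁ hq hD he hDg
  rw [hcl]
  exact hη.re_poincarePairing_wedgePow_analyticCycleClass_pos Φ e₁ hZ' hZ

/-- … and `(D^d · Z)` is then a POSITIVE INTEGER. [cite: Lange2023AbelianVarietiesComplex, §2.1.3 Prop. 2.1.11 and §2.2.1 Lemma 2.2.2 (a)(ii)] [cite: Fulton1998, §12.2 Cor. 12.2 (d)] -/
theorem exists_pos_poincarePairing_wedgePow_analyticCycleClass_hypersurface_eq_of_top_ne_zero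
    (hq : 2 * q + 2 * 1 = 2 * g) (hZ' : 2 * d + 2 * p = 2 * g) {D Z : Set (ComplexTorus Φ)}
    (hD : HasPureDim 𝓘(ℂ, E) D q) (hZ : HasPureDim 𝓘(ℂ, E) Z d) (he : orientationSign Φ e₁ = 1)
    (hDg : torusIntegral Φ e₁ (wedgePow (analyticCycleClass Φ e₁ hq hD) g) ≠ 0) :
    ∃ m : ℕ, 0 < m ∧
      poincarePairing Φ e₁ hZ' (wedgePow (analyticCycleClass Φ e₁ hq hD) d) (analyticCycleClass Φ e₁ hZ' hZ) = m := by
  obtain ⟨η, hη, hcl⟩ :=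
    exists_isRiemannForm_analyticCycleClass_eq_of_torusIntegral_wedgePow_ne_zero Φ e₁ hq hD he hDg
  rw [hcl]
  exact hη.exists_pos_poincarePairing_wedgePow_analyticCycleClass_eq Φ e₁ hZ' hZ

end AnyDim

end ComplexTorus

end Literature.Geometry.Kaehler

end
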